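import Literature.NumberTheory.Automorphic.HyperspecialUnitaryIwasawa
import Literature.NumberTheory.Automorphic.QuasiSplitUnitaryCartanFramesTame
import HarnessLib

/-!
# Cartan decomposition of the quasi-split unitary group `U(σ, J₀)(K)`, `J₀ = antidiag(1,…,1)`, for ANY uniformiser —
# II: matrix form `U(σ, J₀) = K₀ · T · K₀`, `K₀ = U ∩ GL_N(𝒪)` (unramified and TAMELY RAMIFIED quadratic `K/K^σ` alike;
# Tits 1979 §3.3.3; Bruhat–Tits 1972 (4.4.3))

Topic `NumberTheory/Automorphic`; namespace `Literature.NumberTheory.Automorphic.HermitianLattice`.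
THEOREMS only; no definition, no instance, no notation, no named fact, no `sorry`.  Sequel of
`QuasiSplitUnitaryCartanFramesTame` (frame induction) — the any-uniformiser version of ★ `HyperspecialUnitaryCartan`
(imports ★ `HyperspecialUnitaryIwasawa` for the torus lemma `B₀_diagonal_mulVec_of_norm` and `unitaryInt`).

Hypotheses: the five bare binders `hσ : σ ∘ σ = id`, `hvσ : v ∘ σ = v`, `hϖ : v ϖ = exp (-1)` (ANY uniformiser of `K`),
(trace) `htrace : ∃ t, v t ≤ 1 ∧ t + σ t = 1`, (norm) `hnorm` — they hold at every unramified place (fields of ★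
`UnramifiedLocalConjDatum`) and at every TAMELY ramified place of a quadratic extension of non-archimedean local fields
(`t = ½`; Hensel), and (trace) fails at the wild ones.  At a ramified place `K₀ = U(σ, J₀) ∩ GL_N(𝒪)` is the stabiliser
of the self-dual lattice `𝒪^N` — a special (not hyperspecial) maximal compact subgroup — and the torus representatives
are the `diag(d)` with `σ(d_i) d_{N-1-i} = 1`, e.g. `diag(ϖ^{a_1}, …, ϖ^{a_n}, (1), (σϖ)^{-a_n}, …, (σϖ)^{-a_1})`.

* `diag(d)` with `σ(d i) · d (rev i) = 1` preserves `B₀`: ★ `B₀_diagonal_mulVec_of_norm` (`HyperspecialUnitaryIwasawa`, imported).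
* **`exists_cartan_antidiagonal_of_trace_norm`** — for `g ∈ U(σ, J₀)`: `k₁ g k₂ = diag(d)` with `k₁, k₂ ∈ U(σ, J₀)`
  integral with integral inverses and `σ(d i) · d (rev i) = 1`.
* `exists_cartan_antidiagonal_of_unramifiedLocalConjDatum'` — the ★ datum supplies the five binders (statement with the
  one-clause diagonal condition).
The normalisation of `d` to the Witt cone `∏_α a_α(ϖ)^{n_α}` (sorting inside the relative Weyl group, unit part into
`K₀`) is done by the consumer (`Summits/…/Theorems/K2E3WittCartanTameRamified`).

References: J. Tits, *Reductive groups over local fields*, PSPUM 33.1 (1979), §3.3.3 [Tits1979];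
F. Bruhat, J. Tits, *Groupes réductifs sur un corps local I*, Publ. IHÉS 41 (1972), (4.4.3) [BruhatTits1972];
O. T. O'Meara, *Introduction to Quadratic Forms* (1963), §81A, §82F [Omeara1963].
-/

noncomputable section

open scoped Valued WithZero Matrix

namespace Literature.NumberTheory.Automorphic.HermitianLattice

variable {K : Type*} [Field K] [Valued K ℤᵐ⁰] {σ : K →+* K} {ϖ : K} {N : ℕ}

/-! ## The Cartan decomposition in matrix form, any uniformiser -/

/-- **Cartan decomposition of `U(σ, J₀)` relative to `K₀ = U(σ, J₀) ∩ GL_N(𝒪)` — any uniformiser, (trace) + (norm)**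
(the unramified and the tamely ramified quadratic case alike).  For `g ∈ U(σ, J₀)` there are `k₁, k₂ ∈ U(σ, J₀)` with
integral entries and integral inverses and `d : Fin N → K` with `σ(d i) · d (rev i) = 1` (i.e. `diag(d) ∈ U(σ, J₀)`) such
that `k₁ g k₂ = diag(d)`.  Lattice proof = ★ `UnramifiedLocalConjDatum.exists_cartan_antidiagonal`:
`exists_frame_cartan_of_trace_norm` for `M = g 𝒪^N`. [cite: Tits1979, §3.3.3] [cite: BruhatTits1972, (4.4.3)] -/
theorem exists_cartan_antidiagonal_of_trace_norm (hσ : ∀ x, σ (σ x) = x) (hvσ : ∀ x, Valued.v (σ x) = Valued.v x)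
    (hϖ : Valued.v ϖ = WithZero.exp (-1 : ℤ)) (htrace : ∃ t : K, Valued.v t ≤ 1 ∧ t + σ t = 1)
    (hnorm : ∀ u : K, σ u = u → Valued.v (u - 1) < 1 → ∃ z : K, z * σ z = u ∧ Valued.v (z - 1) ≤ Valued.v (u - 1))
    (g : GL (Fin N) K)
    (hg : g ∈ unitaryGroupOfForm σ ((StdForm.antidiagonal N).over K)) :
    ∃ k₁ k₂ : GL (Fin N) K,
      k₁ ∈ unitaryGroupOfForm σ ((StdForm.antidiagonal N).over K) ∧
      (∀ i j, Valued.v ((k₁ : Matrix (Fin N) (Fin N) K) i j) ≤ 1) ∧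
      (∀ i j, Valued.v (((k₁⁻¹ : GL (Fin N) K) : Matrix (Fin N) (Fin N) K) i j) ≤ 1) ∧
      k₂ ∈ unitaryGroupOfForm σ ((StdForm.antidiagonal N).over K) ∧
      (∀ i j, Valued.v ((k₂ : Matrix (Fin N) (Fin N) K) i j) ≤ 1) ∧
      (∀ i j, Valued.v (((k₂⁻¹ : GL (Fin N) K) : Matrix (Fin N) (Fin N) K) i j) ≤ 1) ∧
      ∃ d : Fin N → K, ((k₁ * g * k₂ : GL (Fin N) K) : Matrix (Fin N) (Fin N) K) = Matrix.diagonal d ∧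
        ∀ i, σ (d i) * d (Fin.rev i) = 1 := by
  -- `g` as a linear automorphism
  have hmul : ∀ a b : GL (Fin N) K, (Matrix.toLin' (a : Matrix (Fin N) (Fin N) K)).comp
      (Matrix.toLin' (b : Matrix (Fin N) (Fin N) K)) = Matrix.toLin' ((a * b : GL (Fin N) K) : Matrix _ _ K) :=
    fun a b => by rw [Units.val_mul, Matrix.toLin'_mul]
  let gE : (Fin N → K) ≃ₗ[K] (Fin N → K) :=
    LinearEquiv.ofLinear (Matrix.toLin' (g : Matrix (Fin N) (Fin N) K))
      (Matrix.toLin' ((g⁻¹ : GL (Fin N) K) : Matrix (Fin N) (Fin N) K))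
      (by rw [hmul, mul_inv_cancel, Units.val_one, Matrix.toLin'_one])
      (by rw [hmul, inv_mul_cancel, Units.val_one, Matrix.toLin'_one])
  have hgE : ∀ u, gE u = (g : Matrix (Fin N) (Fin N) K).mulVec u := fun u => Matrix.toLin'_apply _ _
  have hgiso : ∀ u v, B₀ σ N (gE u) (gE v) = B₀ σ N u v := fun u v => by
    rw [hgE, hgE]; exact (mem_unitaryGroupOfForm_antidiagonal_iff g).1 hg u v
  -- `M = g 𝒪^N` is a unimodular lattice in `K^N = frame univ`
  have hrev : ∀ i ∈ (Finset.univ : Finset (Fin N)), Fin.rev i ∈ Finset.univ := fun _ _ => Finset.mem_univ _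
  have hL := isUnimodularLattice_frameLattice (K := K) (N := N) hvσ hrev
  have hM := hL.map_equiv' gE hgiso
  rw [frameLattice_univ, frame_univ, Submodule.map_top, LinearEquiv.range, ← frame_univ] at hM
  obtain ⟨ψ, d, hψiso, -, hψL, hdinv, -, hEq⟩ :=
    exists_frame_cartan_of_trace_norm hσ hvσ hϖ htrace hnorm Finset.univ hrev _ hM
  rw [frameLattice_univ] at hEq
  -- the matrices `Ψ` of `ψ` and `T = diag(d)`
  have hcomp : ψ.toLinearMap.comp ψ.symm.toLinearMap = LinearMap.id := LinearMap.ext fun z => ψ.apply_symm_apply z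
  have hcomp' : ψ.symm.toLinearMap.comp ψ.toLinearMap = LinearMap.id :=
    LinearMap.ext fun z => ψ.symm_apply_apply z
  let Ψ : GL (Fin N) K :=
    ⟨LinearMap.toMatrix' ψ.toLinearMap, LinearMap.toMatrix' ψ.symm.toLinearMap,
      by rw [← LinearMap.toMatrix'_comp, hcomp, LinearMap.toMatrix'_id],
      by rw [← LinearMap.toMatrix'_comp, hcomp', LinearMap.toMatrix'_id]⟩
  have hΨ : Matrix.toLin' (Ψ : Matrix (Fin N) (Fin N) K) = ψ.toLinearMap := Matrix.toLin'_toMatrix' _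
  have hdinv' : ∀ i, d i * σ (d (Fin.rev i)) = 1 := fun i => by
    have h := hdinv (Fin.rev i)
    rwa [Fin.rev_rev, mul_comm] at h
  let T : GL (Fin N) K :=
    ⟨Matrix.diagonal d, Matrix.diagonal fun i => σ (d (Fin.rev i)),
      by rw [Matrix.diagonal_mul_diagonal, ← Matrix.diagonal_one]; exact congrArg _ (funext hdinv'),
      by rw [Matrix.diagonal_mul_diagonal, ← Matrix.diagonal_one]
         exact congrArg _ (funext fun i => by rw [mul_comm]; exact hdinv' i)⟩
  -- unitarity of `Ψ` and `T`
  have hΨU : Ψ ∈ unitaryGroupOfForm σ ((StdForm.antidiagonal N).over K) := by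
    rw [mem_unitaryGroupOfForm_antidiagonal_iff]
    intro u v
    rw [← Matrix.toLin'_apply, ← Matrix.toLin'_apply, hΨ]
    exact hψiso u v
  have hTU : T ∈ unitaryGroupOfForm σ ((StdForm.antidiagonal N).over K) := by
    rw [mem_unitaryGroupOfForm_antidiagonal_iff]
    exact B₀_diagonal_mulVec_of_norm hdinv
  -- `k := T⁻¹ Ψ⁻¹ g` stabilises `𝒪^N`
  have hLg : (stdLattice K N).map ((Matrix.toLin' (g : Matrix (Fin N) (Fin N) K)).restrictScalars 𝒪[K]) =
      ((stdLattice K N).map ((Matrix.toLin' (T : Matrix (Fin N) (Fin N) K)).restrictScalars 𝒪[K])).map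
        ((Matrix.toLin' (Ψ : Matrix (Fin N) (Fin N) K)).restrictScalars 𝒪[K]) := by
    rw [hΨ]; exact hEq
  set k : GL (Fin N) K := T⁻¹ * Ψ⁻¹ * g with hk
  have hkL : (stdLattice K N).map ((Matrix.toLin' (k : Matrix (Fin N) (Fin N) K)).restrictScalars 𝒪[K]) =
      stdLattice K N := by
    have hkval : (k : Matrix (Fin N) (Fin N) K) =
        ((T⁻¹ : GL (Fin N) K) : Matrix (Fin N) (Fin N) K) * (((Ψ⁻¹ : GL (Fin N) K) : Matrix (Fin N) (Fin N) K) *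
          (g : Matrix (Fin N) (Fin N) K)) := by
      rw [hk, Units.val_mul, Units.val_mul, Matrix.mul_assoc]
    rw [hkval, map_toLin'_mul, map_toLin'_mul, hLg,
      ← map_toLin'_mul ((Ψ⁻¹ : GL (Fin N) K) : Matrix (Fin N) (Fin N) K) ((Ψ : GL (Fin N) K) : Matrix (Fin N) (Fin N) K),
      ← Units.val_mul, inv_mul_cancel, Units.val_one, map_toLin'_one,
      ← map_toLin'_mul ((T⁻¹ : GL (Fin N) K) : Matrix (Fin N) (Fin N) K) ((T : GL (Fin N) K) : Matrix (Fin N) (Fin N) K),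
      ← Units.val_mul, inv_mul_cancel, Units.val_one, map_toLin'_one]
  have hΨL : (stdLattice K N).map ((Matrix.toLin' (Ψ : Matrix (Fin N) (Fin N) K)).restrictScalars 𝒪[K]) =
      stdLattice K N := by rw [hΨ]; exact hψL
  obtain ⟨hΨ1, hΨ2⟩ := v_le_one_of_map_stdLattice_eq Ψ hΨL
  obtain ⟨hk1, hk2⟩ := v_le_one_of_map_stdLattice_eq k hkL
  have hkU : k ∈ unitaryGroupOfForm σ ((StdForm.antidiagonal N).over K) :=
    Subgroup.mul_mem _ (Subgroup.mul_mem _ (Subgroup.inv_mem _ hTU) (Subgroup.inv_mem _ hΨU)) hg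
  refine ⟨Ψ⁻¹, k⁻¹, Subgroup.inv_mem _ hΨU, hΨ2, by rw [inv_inv]; exact hΨ1, Subgroup.inv_mem _ hkU, hk2,
    by rw [inv_inv]; exact hk1, d, ?_, hdinv⟩
  have : Ψ⁻¹ * g * k⁻¹ = T := by rw [hk]; group
  rw [this]

/-- The ★ unramified datum supplies the five binders: `exists_cartan_antidiagonal_of_trace_norm` for
`UnramifiedLocalConjDatum σ ϖ` (one-clause diagonal condition; the ★ two-clause form `σ d = d ∧ d_i d_{rev i} = 1` is ★
`UnramifiedLocalConjDatum.exists_cartan_antidiagonal`). [cite: Tits1979, §3.3.3] -/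
theorem exists_cartan_antidiagonal_of_unramifiedLocalConjDatum' (hd : UnramifiedLocalConjDatum σ ϖ) (g : GL (Fin N) K)
    (hg : g ∈ unitaryGroupOfForm σ ((StdForm.antidiagonal N).over K)) :
    ∃ k₁ k₂ : GL (Fin N) K,
      k₁ ∈ unitaryGroupOfForm σ ((StdForm.antidiagonal N).over K) ∧
      (∀ i j, Valued.v ((k₁ : Matrix (Fin N) (Fin N) K) i j) ≤ 1) ∧
      (∀ i j, Valued.v (((k₁⁻¹ : GL (Fin N) K) : Matrix (Fin N) (Fin N) K) i j) ≤ 1) ∧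
      k₂ ∈ unitaryGroupOfForm σ ((StdForm.antidiagonal N).over K) ∧
      (∀ i j, Valued.v ((k₂ : Matrix (Fin N) (Fin N) K) i j) ≤ 1) ∧
      (∀ i j, Valued.v (((k₂⁻¹ : GL (Fin N) K) : Matrix (Fin N) (Fin N) K) i j) ≤ 1) ∧
      ∃ d : Fin N → K, ((k₁ * g * k₂ : GL (Fin N) K) : Matrix (Fin N) (Fin N) K) = Matrix.diagonal d ∧
        ∀ i, σ (d i) * d (Fin.rev i) = 1 :=
  exists_cartan_antidiagonal_of_trace_norm hd.σσ hd.vσ hd.vϖ hd.trace hd.norm g hg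

end Literature.NumberTheory.Automorphic.HermitianLattice

end
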